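import Mathlib

/-!
# Zhang (2022) §§7, 11, 12: the window-coupled counting bound behind the absolute-value estimate
# of `S_j(𝐚₁,𝐚₂)` for window-supported sequences ("(8.25)/(8.26) and simple estimates")

Topic `Literature/NumberTheory/LFunctions/Zhang2022` (Landau–Siegel audit tree; verdict-neutral).
Y. Zhang, *Discrete mean estimates and the Landau–Siegel zero*, arXiv:2211.02515v1 (2022)
[Zhang2022LandauSiegel], §7 Prop. 7.1 (the arithmetic sums
`S_j(𝐚₁,𝐚₂) = Σ_dΣ_r |μ(r)|λ₀ⱼ(dr)/(drφ(r)) (Σ_m a₁(drm)m^{−(1−β_j)})(Σ_n a₂(drn)ξ₀ⱼ(n;d,r)/n)`),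
§11 p. 64 and §12 p. 67 ("… by (8.25), (8.26) and simple estimates"; the displays (8.25)/(8.26) do
not exist in v1) — **an unrefereed manuscript under adjudication; nothing here asserts or denies
its Theorems 1–2** (ZHANG-L discharge lane, WP11/WP12).

This file is PURE ELEMENTARY COUNTING, independent of the manuscript's objects: it bounds the
triple sum that majorises `|S_j(𝐚₁,𝐚₂)|` when `𝐚₁` is supported on a window `W = (Y, Y(1+δ)]`
and `𝐚₂` on a window `W' = (Y', Y'(1+δ')]` (after `|λ₀ⱼ(dr)|`, `|ξ₀ⱼ(n;d,r)|` are replaced by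
majorants `c(k)` (`k = dr`) and `G(n)`):

`T = Σ_k (c(k)/k) · (Σ_{m : km ∈ W} 1/m) · (Σ_{n : kn ∈ W'} G(n)/n)`.

**`window_triple_sum_le`**: if `Σ_{n≤X} G(n) ≤ AX`, `Σ_{n≤X} G(n)/n ≤ A(1 + log X)`,
`Σ_{n≤X} G(n)/√n ≤ A√X` and `Σ_{y<k≤y+h} c(k) ≤ A'(h + √(y+h))`, then
`T ≤ AA'·(2δ(δ'(1 + log 2Y') + 2) + 4δ(1 + log(2/δ)) + 16/√(δY))`.
The point (versus decoupling the `d, r` ranges from the windows, which costs two logarithmic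
ranges `(log P)²`): the conditions `km ∈ W`, `kn ∈ W'` COUPLE the three variables, so that for
`k ≤ δY` the `m`-window has harmonic mass `≤ 2δ` while the `(k,n)`-sum is a short sum of the
Dirichlet convolution `c ∗ G` over `W'`, and for `k > δY` only `m < 2/δ` occur and the `k`-sum is a
short sum of `c` over `W/m`. No statement about the manuscript's Theorems 1–2 or about
Landau–Siegel zeros is made or implied.

## References

* Y. Zhang, arXiv:2211.02515v1 (2022), §7 Prop. 7.1 p. 33; §11 p. 64; §12 p. 67.
  [cite: Zhang2022LandauSiegel, §7 Prop. 7.1 p.33; §11 p.64; §12 p.67]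
-/

noncomputable section

open Finset Real

namespace Literature.NumberTheory.LFunctions.Zhang2022.SjWindowEngine

/-! ### Part 1. Counting integers in real intervals, and two harmonic-type sums -/

/-- The integers `m ≥ 1`, `m ≤ N`, of a real interval `(a, b]` (`0 ≤ a ≤ b`) number at most
`b − a + 1`. [folklore] -/
private theorem card_filter_Ioc_le (N : ℕ) {a b : ℝ} (ha : 0 ≤ a) (hab : a ≤ b) :
    (((Icc 1 N).filter (fun m : ℕ => a < (m : ℝ) ∧ (m : ℝ) ≤ b)).card : ℝ) ≤ b - a + 1 := by
  have hsub : (Icc 1 N).filter (fun m : ℕ => a < (m : ℝ) ∧ (m : ℝ) ≤ b) ⊆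
      Finset.Ioc ⌊a⌋₊ ⌊b⌋₊ := by
    intro m hm
    rw [mem_filter] at hm
    rw [Finset.mem_Ioc]
    constructor
    · exact (Nat.floor_lt ha).mpr hm.2.1
    · exact Nat.le_floor hm.2.2
  have hcard := Finset.card_le_card hsub
  rw [Nat.card_Ioc] at hcard
  have h1 : (((Icc 1 N).filter (fun m : ℕ => a < (m : ℝ) ∧ (m : ℝ) ≤ b)).card : ℝ) ≤
      ((⌊b⌋₊ - ⌊a⌋₊ : ℕ) : ℝ) := by exact_mod_cast hcard
  have hfl : ⌊a⌋₊ ≤ ⌊b⌋₊ := Nat.floor_le_floor hab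
  rw [Nat.cast_sub hfl] at h1
  have hb : (⌊b⌋₊ : ℝ) ≤ b := Nat.floor_le (ha.trans hab)
  have ha' : a < (⌊a⌋₊ : ℝ) + 1 := Nat.lt_floor_add_one a
  linarith

/-- **Harmonic mass of a window**: if `1 ≤ k ≤ δY` then `Σ_{m : Y < km ≤ Y(1+δ)} 1/m ≤ 2δ`
(at most `δY/k + 1 ≤ 2δY/k` integers `m`, each with `1/m < k/Y`). [folklore] -/
private theorem sum_window_inv_le (N : ℕ) {k : ℕ} (hk : 1 ≤ k) {Y δ : ℝ} (hY : 0 < Y) (hδ : 0 < δ)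
    (hkδ : (k : ℝ) ≤ δ * Y) :
    ∑ m ∈ (Icc 1 N).filter (fun m : ℕ => Y < (k : ℝ) * m ∧ (k : ℝ) * m ≤ Y * (1 + δ)),
      (1 : ℝ) / m ≤ 2 * δ := by
  have hk0 : (0 : ℝ) < k := by exact_mod_cast hk
  set S := (Icc 1 N).filter (fun m : ℕ => Y < (k : ℝ) * m ∧ (k : ℝ) * m ≤ Y * (1 + δ)) with hS
  -- each term is at most `k/Y`
  have hterm : ∀ m ∈ S, (1 : ℝ) / m ≤ k / Y := by
    intro m hm
    rw [hS, mem_filter] at hm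
    have hm0 : (0 : ℝ) < m := by exact_mod_cast (mem_Icc.mp hm.1).1
    rw [div_le_div_iff₀ hm0 hY]
    linarith [hm.2.1]
  -- the number of terms
  have hcard : (S.card : ℝ) ≤ 2 * δ * Y / k := by
    have hS' : S = (Icc 1 N).filter (fun m : ℕ => Y / k < (m : ℝ) ∧ (m : ℝ) ≤ Y * (1 + δ) / k) := by
      rw [hS]
      refine filter_congr fun m _ => ?_
      rw [div_lt_iff₀ hk0, le_div_iff₀ hk0, mul_comm (m : ℝ) k]
    have h1 : (S.card : ℝ) ≤ Y * (1 + δ) / k - Y / k + 1 := by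
      rw [hS']
      exact card_filter_Ioc_le N (div_nonneg hY.le hk0.le)
        (div_le_div_of_nonneg_right (by nlinarith) hk0.le)
    have h2 : Y * (1 + δ) / k - Y / k = δ * Y / k := by
      field_simp; ring
    rw [h2] at h1
    have h3 : (1 : ℝ) ≤ δ * Y / k := by rw [le_div_iff₀ hk0, one_mul]; exact hkδ
    have h4 : 2 * δ * Y / k = 2 * (δ * Y / k) := by ring
    linarith
  calc ∑ m ∈ S, (1 : ℝ) / m ≤ ∑ m ∈ S, (k : ℝ) / Y := sum_le_sum hterm
    _ = S.card * ((k : ℝ) / Y) := by rw [sum_const, nsmul_eq_mul]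
    _ ≤ (2 * δ * Y / k) * ((k : ℝ) / Y) :=
        mul_le_mul_of_nonneg_right hcard (div_nonneg hk0.le hY.le)
    _ = 2 * δ := by field_simp

/-- `Σ_{m=1}^{M} 1/√m ≤ 2√M`. [folklore] -/
private theorem sum_inv_sqrt_le (M : ℕ) : ∑ m ∈ Icc 1 M, (1 : ℝ) / Real.sqrt m ≤ 2 * Real.sqrt M := by
  induction M with
  | zero => simp
  | succ M ih =>
    rw [Finset.sum_Icc_succ_top (Nat.succ_le_succ (Nat.zero_le M)), Nat.cast_succ]
    have hM0 : (0 : ℝ) ≤ M := Nat.cast_nonneg M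
    have h1 : 0 < Real.sqrt ((M : ℝ) + 1) := Real.sqrt_pos.mpr (by linarith)
    -- `1/√(M+1) ≤ 2(√(M+1) − √M)`
    have hkey : 1 / Real.sqrt ((M : ℝ) + 1) ≤ 2 * (Real.sqrt ((M : ℝ) + 1) - Real.sqrt M) := by
      rw [div_le_iff₀ h1]
      have hsq1 : Real.sqrt ((M : ℝ) + 1) ^ 2 = (M : ℝ) + 1 := Real.sq_sqrt (by linarith)
      have hsq0 : Real.sqrt (M : ℝ) ^ 2 = (M : ℝ) := Real.sq_sqrt hM0
      have hle : Real.sqrt (M : ℝ) ≤ Real.sqrt ((M : ℝ) + 1) := Real.sqrt_le_sqrt (by linarith)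
      nlinarith [Real.sqrt_nonneg (M : ℝ), sq_nonneg (Real.sqrt ((M : ℝ) + 1) - Real.sqrt M)]
    linarith

/-- `Σ_{m=1}^{M} 1/m ≤ 1 + log M` (and `≤ 1` for `M = 0`, as `log 0 = 0`). [folklore] -/
private theorem sum_inv_le_one_add_log (M : ℕ) : ∑ m ∈ Icc 1 M, (1 : ℝ) / m ≤ 1 + Real.log M := by
  rcases Nat.eq_zero_or_pos M with rfl | hM
  · simp
  · have h := harmonic_le_one_add_log M
    have e : ∑ m ∈ Icc 1 M, (1 : ℝ) / m = (harmonic M : ℝ) := by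
      rw [harmonic_eq_sum_Icc]
      push_cast
      refine sum_congr rfl fun m _ => ?_
      rw [one_div]
    rw [e]
    exact h


/-! ### Part 2. The `(k,n)`-sum: a short sum of the convolution `c ∗ G` over `W'` -/

section Engine

variable {c G : ℕ → ℝ} {A A' : ℝ}

/-- **The `(k,n)`-sum.** For `Y' ≥ 1`, `0 < δ' ≤ 1`:
`Σ_k (c(k)/k) Σ_{n : Y' < kn ≤ Y'(1+δ')} G(n)/n ≤ AA'(δ'(1 + log 2Y') + 2)`
(`1/(kn) < 1/Y'`; for each `n ≤ 2Y'` the `k` run over `(Y'/n, Y'(1+δ')/n]`, a short sum of `c`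
of length `δ'Y'/n`; then `Σ_{n≤2Y'} G(n)(δ'/n + √2/√(Y'n))`). [cite: Zhang2022LandauSiegel, §12 p.67] -/
theorem sum_kn_window_le (hc : ∀ k, 0 ≤ c k) (hG : ∀ n, 0 ≤ G n) (hA : 0 ≤ A) (hA' : 0 ≤ A')
    (hG2 : ∀ X : ℕ, ∑ n ∈ Icc 1 X, G n / n ≤ A * (1 + Real.log X))
    (hG3 : ∀ X : ℕ, ∑ n ∈ Icc 1 X, G n / Real.sqrt n ≤ A * Real.sqrt X)
    (hc1 : ∀ (K : ℕ) (y h : ℝ), 0 ≤ y → 0 ≤ h →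
      ∑ k ∈ (Icc 1 K).filter (fun k : ℕ => y < (k : ℝ) ∧ (k : ℝ) ≤ y + h), c k ≤
        A' * (h + Real.sqrt (y + h)))
    {Y' δ' : ℝ} (hY' : 1 ≤ Y') (hδ' : 0 < δ') (hδ'1 : δ' ≤ 1) (K N : ℕ) :
    ∑ k ∈ Icc 1 K, c k / k *
        (∑ n ∈ Icc 1 N, if Y' < (k : ℝ) * n ∧ (k : ℝ) * n ≤ Y' * (1 + δ') then G n / n else 0) ≤
      A * A' * (δ' * (1 + Real.log (2 * Y')) + 2) := by
  have hY'0 : 0 < Y' := by linarith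
  -- Step 1: termwise `c(k)/k · G(n)/n ≤ c(k) G(n)/Y'` on the window, then exchange the sums
  set X' : ℕ := min N ⌊2 * Y'⌋₊ with hX'
  have hstep1 : ∑ k ∈ Icc 1 K, c k / k *
        (∑ n ∈ Icc 1 N, if Y' < (k : ℝ) * n ∧ (k : ℝ) * n ≤ Y' * (1 + δ') then G n / n else 0) ≤
      ∑ n ∈ Icc 1 X', G n / Y' *
        ∑ k ∈ (Icc 1 K).filter (fun k : ℕ => Y' / n < (k : ℝ) ∧ (k : ℝ) ≤ Y' / n + δ' * Y' / n),
          c k := by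
    calc ∑ k ∈ Icc 1 K, c k / k *
          (∑ n ∈ Icc 1 N, if Y' < (k : ℝ) * n ∧ (k : ℝ) * n ≤ Y' * (1 + δ') then G n / n else 0)
        = ∑ k ∈ Icc 1 K, ∑ n ∈ Icc 1 N,
            (if Y' < (k : ℝ) * n ∧ (k : ℝ) * n ≤ Y' * (1 + δ') then c k / k * (G n / n) else 0) := by
          refine sum_congr rfl fun k _ => ?_
          rw [mul_sum]
          refine sum_congr rfl fun n _ => ?_
          split_ifs <;> simp
      _ ≤ ∑ k ∈ Icc 1 K, ∑ n ∈ Icc 1 N,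
            (if Y' < (k : ℝ) * n ∧ (k : ℝ) * n ≤ Y' * (1 + δ') then G n / Y' * c k else 0) := by
          refine sum_le_sum fun k hk => sum_le_sum fun n hn => ?_
          split_ifs with h
          · have hk0 : (0 : ℝ) < k := by exact_mod_cast (mem_Icc.mp hk).1
            have hn0 : (0 : ℝ) < n := by exact_mod_cast (mem_Icc.mp hn).1
            have hkn : Y' < (k : ℝ) * n := h.1
            rw [div_mul_div_comm, div_mul_eq_mul_div, div_le_div_iff₀ (by positivity) hY'0]
            calc c k * G n * Y' ≤ c k * G n * ((k : ℝ) * n) :=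
                  mul_le_mul_of_nonneg_left hkn.le (mul_nonneg (hc k) (hG n))
              _ = G n * c k * ((k : ℝ) * n) := by ring
          · exact le_rfl
      _ = ∑ n ∈ Icc 1 N, ∑ k ∈ Icc 1 K,
            (if Y' < (k : ℝ) * n ∧ (k : ℝ) * n ≤ Y' * (1 + δ') then G n / Y' * c k else 0) :=
          sum_comm
      _ = ∑ n ∈ Icc 1 N, G n / Y' *
            ∑ k ∈ (Icc 1 K).filter (fun k : ℕ => Y' / n < (k : ℝ) ∧ (k : ℝ) ≤ Y' / n + δ' * Y' / n),
              c k := by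
          refine sum_congr rfl fun n hn => ?_
          have hn0 : (0 : ℝ) < n := by exact_mod_cast (mem_Icc.mp hn).1
          rw [sum_filter, mul_sum]
          refine sum_congr rfl fun k _ => ?_
          have e : (Y' < (k : ℝ) * n ∧ (k : ℝ) * n ≤ Y' * (1 + δ')) ↔
              (Y' / n < (k : ℝ) ∧ (k : ℝ) ≤ Y' / n + δ' * Y' / n) := by
            rw [div_lt_iff₀ hn0, ← add_div, le_div_iff₀ hn0]
            constructor
            · rintro ⟨h1, h2⟩; exact ⟨h1, by linarith⟩
            · rintro ⟨h1, h2⟩; exact ⟨h1, by linarith⟩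
          simp only [e]
          split_ifs <;> simp
      _ = ∑ n ∈ Icc 1 X', G n / Y' *
            ∑ k ∈ (Icc 1 K).filter (fun k : ℕ => Y' / n < (k : ℝ) ∧ (k : ℝ) ≤ Y' / n + δ' * Y' / n),
              c k := by
          -- the terms with `n > 2Y'` vanish: `k ≥ 1` forces `kn ≥ n > Y'(1+δ')`
          symm
          rw [hX']
          have hsub : Icc 1 (min N ⌊2 * Y'⌋₊) ⊆ Icc 1 N := by
            intro n hn
            rw [mem_Icc] at hn ⊢
            exact ⟨hn.1, hn.2.trans (min_le_left _ _)⟩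
          refine sum_subset hsub fun n hn hn' => ?_
          have hn1 := (mem_Icc.mp hn).1
          have hnN := (mem_Icc.mp hn).2
          have hn2 : ¬ n ≤ ⌊2 * Y'⌋₊ := by
            intro h
            exact hn' (mem_Icc.mpr ⟨hn1, le_min hnN h⟩)
          have hn2' : 2 * Y' < n := by
            rw [Nat.le_floor_iff (by linarith)] at hn2
            push Not at hn2
            exact hn2
          have hn0 : (0 : ℝ) < n := by exact_mod_cast hn1
          have hempty : (Icc 1 K).filter
              (fun k : ℕ => Y' / n < (k : ℝ) ∧ (k : ℝ) ≤ Y' / n + δ' * Y' / n) = ∅ := by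
            refine filter_eq_empty_iff.mpr fun k hk h => ?_
            have hk1 : (1 : ℝ) ≤ k := by exact_mod_cast (mem_Icc.mp hk).1
            have h2 := h.2
            rw [← add_div, le_div_iff₀ hn0] at h2
            nlinarith
          rw [hempty, sum_empty, mul_zero]
  -- Step 2: the short sums of `c`
  have hstep2 : ∀ n ∈ Icc 1 X',
      G n / Y' * ∑ k ∈ (Icc 1 K).filter
          (fun k : ℕ => Y' / n < (k : ℝ) ∧ (k : ℝ) ≤ Y' / n + δ' * Y' / n), c k ≤
        A' * (δ' * (G n / n) + Real.sqrt 2 / Real.sqrt Y' * (G n / Real.sqrt n)) := by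
    intro n hn
    have hn0 : (0 : ℝ) < n := by exact_mod_cast (mem_Icc.mp hn).1
    have hy : 0 ≤ Y' / n := div_nonneg hY'0.le hn0.le
    have hh : 0 ≤ δ' * Y' / n := by positivity
    have hb := hc1 K (Y' / n) (δ' * Y' / n) hy hh
    have hsq : Real.sqrt (Y' / n + δ' * Y' / n) ≤ Real.sqrt 2 * Real.sqrt Y' / Real.sqrt n := by
      rw [← Real.sqrt_mul (by norm_num : (0 : ℝ) ≤ 2), ← Real.sqrt_div (by positivity)]
      apply Real.sqrt_le_sqrt
      rw [← add_div, div_le_div_iff_of_pos_right hn0]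
      nlinarith
    have hGY : 0 ≤ G n / Y' := div_nonneg (hG n) hY'0.le
    calc G n / Y' * ∑ k ∈ (Icc 1 K).filter
            (fun k : ℕ => Y' / n < (k : ℝ) ∧ (k : ℝ) ≤ Y' / n + δ' * Y' / n), c k
        ≤ G n / Y' * (A' * (δ' * Y' / n + Real.sqrt (Y' / n + δ' * Y' / n))) :=
          mul_le_mul_of_nonneg_left hb hGY
      _ ≤ G n / Y' * (A' * (δ' * Y' / n + Real.sqrt 2 * Real.sqrt Y' / Real.sqrt n)) := by
          gcongr
      _ = A' * (δ' * (G n / n)) * (Y' / Y') +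
            A' * (Real.sqrt 2 * (G n / Real.sqrt n)) * (Real.sqrt Y' / Y') := by ring
      _ = A' * (δ' * (G n / n) + Real.sqrt 2 / Real.sqrt Y' * (G n / Real.sqrt n)) := by
          rw [div_self hY'0.ne', Real.sqrt_div_self']
          ring
  -- Step 3: the two `G`-means over `n ≤ X' ≤ 2Y'`
  have hX'le : (X' : ℝ) ≤ 2 * Y' := by
    have : (X' : ℝ) ≤ ⌊2 * Y'⌋₊ := by exact_mod_cast min_le_right _ _
    exact this.trans (Nat.floor_le (by linarith))
  have hlogX' : Real.log X' ≤ Real.log (2 * Y') := by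
    rcases Nat.eq_zero_or_pos X' with h0 | hpos
    · rw [h0, Nat.cast_zero, Real.log_zero]; exact Real.log_nonneg (by linarith)
    · exact Real.log_le_log (by exact_mod_cast hpos) hX'le
  have hsqX' : Real.sqrt X' ≤ Real.sqrt (2 * Y') := Real.sqrt_le_sqrt hX'le
  have h2 := hG2 X'
  have h3 := hG3 X'
  have hs2Y : Real.sqrt 2 / Real.sqrt Y' * (A * Real.sqrt (2 * Y')) = 2 * A := by
    have hsY : 0 < Real.sqrt Y' := Real.sqrt_pos.mpr hY'0
    rw [Real.sqrt_mul (by norm_num : (0:ℝ) ≤ 2)]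
    field_simp
    rw [Real.sq_sqrt (by norm_num : (0:ℝ) ≤ 2)]
    ring
  calc ∑ k ∈ Icc 1 K, c k / k *
        (∑ n ∈ Icc 1 N, if Y' < (k : ℝ) * n ∧ (k : ℝ) * n ≤ Y' * (1 + δ') then G n / n else 0)
      ≤ ∑ n ∈ Icc 1 X', G n / Y' *
          ∑ k ∈ (Icc 1 K).filter (fun k : ℕ => Y' / n < (k : ℝ) ∧ (k : ℝ) ≤ Y' / n + δ' * Y' / n),
            c k := hstep1
    _ ≤ ∑ n ∈ Icc 1 X', A' * (δ' * (G n / n) + Real.sqrt 2 / Real.sqrt Y' * (G n / Real.sqrt n)) :=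
        sum_le_sum hstep2
    _ = A' * (δ' * ∑ n ∈ Icc 1 X', G n / n +
          Real.sqrt 2 / Real.sqrt Y' * ∑ n ∈ Icc 1 X', G n / Real.sqrt n) := by
        rw [← mul_sum, sum_add_distrib, ← mul_sum, ← mul_sum]
    _ ≤ A' * (δ' * (A * (1 + Real.log (2 * Y'))) +
          Real.sqrt 2 / Real.sqrt Y' * (A * Real.sqrt (2 * Y'))) := by
        gcongr
        · exact h2.trans (by gcongr)
        · exact h3.trans (by gcongr)
    _ = A * A' * (δ' * (1 + Real.log (2 * Y')) + 2) := by rw [hs2Y]; ring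


/-! ### Part 3. The `n`-sum is uniformly bounded when the `m`-window is occupied; the tail `k > δY` -/

/-- **The `n`-sum is `O(1)` once `k ∈ W/m`.** If `Y < km ≤ Y(1+δ)` (`k, m ≥ 1`) then
`Σ_{n : Y' < kn ≤ Y'(1+δ')} G(n)/n ≤ A(1+δ)(1+δ')`: the `n` lie below `Y'(1+δ')m/Y` and
`1/n ≤ Y(1+δ)/(Y'm)`, so the sum is `≤ (Y(1+δ)/(Y'm))·Σ_{n ≤ Y'(1+δ')m/Y} G(n)`.
[cite: Zhang2022LandauSiegel, §12 p.67] -/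
theorem sum_n_window_le (hG : ∀ n, 0 ≤ G n) (hA : 0 ≤ A)
    (hG1 : ∀ X : ℕ, ∑ n ∈ Icc 1 X, G n ≤ A * X)
    {Y Y' δ δ' : ℝ} (hY : 0 < Y) (hY' : 0 < Y') (hδ : 0 < δ) (hδ' : 0 < δ') {k m : ℕ} (hk : 1 ≤ k)
    (hm : 1 ≤ m) (hW : Y < (k : ℝ) * m ∧ (k : ℝ) * m ≤ Y * (1 + δ)) (N : ℕ) :
    ∑ n ∈ Icc 1 N, (if Y' < (k : ℝ) * n ∧ (k : ℝ) * n ≤ Y' * (1 + δ') then G n / n else 0) ≤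
      A * (1 + δ) * (1 + δ') := by
  have hk0 : (0 : ℝ) < k := by exact_mod_cast hk
  have hm0 : (0 : ℝ) < m := by exact_mod_cast hm
  set X : ℕ := ⌊Y' * (1 + δ') * m / Y⌋₊ with hX
  have hXnn : 0 ≤ Y' * (1 + δ') * m / Y := by positivity
  -- the coefficient bound `1/n ≤ Y(1+δ)/(Y'm)` and the range `n ≤ X`
  have hterm : ∀ n ∈ Icc 1 N, (if Y' < (k : ℝ) * n ∧ (k : ℝ) * n ≤ Y' * (1 + δ') then G n / n else 0) ≤
      (if n ≤ X then G n * (Y * (1 + δ) / (Y' * m)) else 0) := by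
    intro n hn
    have hn0 : (0 : ℝ) < n := by exact_mod_cast (mem_Icc.mp hn).1
    split_ifs with h1 h2 h2
    · rw [div_eq_mul_one_div]
      refine mul_le_mul_of_nonneg_left ?_ (hG n)
      rw [div_le_div_iff₀ hn0 (by positivity)]
      -- `Y' m ≤ Y(1+δ) n` from `km ≤ Y(1+δ)` and `Y' < kn`
      nlinarith [hW.2, h1.1, mul_pos hk0 hn0]
    · exfalso
      apply h2
      rw [Nat.le_floor_iff hXnn, le_div_iff₀ hY]
      -- `n Y ≤ Y'(1+δ') m` from `kn ≤ Y'(1+δ')` and `Y < km`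
      nlinarith [hW.1, h1.2, mul_pos hk0 hn0]
    · exact mul_nonneg (hG n) (by positivity)
    · exact le_rfl
  have hsub : (Icc 1 N).filter (fun n : ℕ => n ≤ X) ⊆ Icc 1 X := by
    intro n hn
    rw [mem_filter, mem_Icc] at hn
    exact mem_Icc.mpr ⟨hn.1.1, hn.2⟩
  calc ∑ n ∈ Icc 1 N, (if Y' < (k : ℝ) * n ∧ (k : ℝ) * n ≤ Y' * (1 + δ') then G n / n else 0)
      ≤ ∑ n ∈ Icc 1 N, (if n ≤ X then G n * (Y * (1 + δ) / (Y' * m)) else 0) := sum_le_sum hterm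
    _ = ∑ n ∈ (Icc 1 N).filter (fun n : ℕ => n ≤ X), G n * (Y * (1 + δ) / (Y' * m)) := by
        rw [sum_filter]
    _ ≤ ∑ n ∈ Icc 1 X, G n * (Y * (1 + δ) / (Y' * m)) :=
        sum_le_sum_of_subset_of_nonneg hsub fun n _ _ => mul_nonneg (hG n) (by positivity)
    _ = (∑ n ∈ Icc 1 X, G n) * (Y * (1 + δ) / (Y' * m)) := by rw [sum_mul]
    _ ≤ A * X * (Y * (1 + δ) / (Y' * m)) := mul_le_mul_of_nonneg_right (hG1 X) (by positivity)
    _ ≤ A * (Y' * (1 + δ') * m / Y) * (Y * (1 + δ) / (Y' * m)) := by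
        gcongr
        exact Nat.floor_le hXnn
    _ = A * (1 + δ) * (1 + δ') := by field_simp

/-- **The tail `k > δY`.** For `Y, Y' ≥ 1`, `0 < δ, δ' ≤ 1`:
`Σ_{k > δY} (c(k)/k)(Σ_{m : km∈W} 1/m)(Σ_{n : kn∈W'} G(n)/n) ≤ 4AA'(δ(1 + log(2/δ)) + 4/√(δY))`:
only `m < 2/δ` occur, the `n`-sum is `≤ 4A` (`sum_n_window_le`), `1/(km) < 1/Y`, and for each `m`
the `k` run over `(Y/m, Y(1+δ)/m]`, a short sum of `c`. [cite: Zhang2022LandauSiegel, §12 p.67] -/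
theorem sum_tail_window_le (hc : ∀ k, 0 ≤ c k) (hG : ∀ n, 0 ≤ G n) (hA : 0 ≤ A) (hA' : 0 ≤ A')
    (hG1 : ∀ X : ℕ, ∑ n ∈ Icc 1 X, G n ≤ A * X)
    (hc1 : ∀ (K : ℕ) (y h : ℝ), 0 ≤ y → 0 ≤ h →
      ∑ k ∈ (Icc 1 K).filter (fun k : ℕ => y < (k : ℝ) ∧ (k : ℝ) ≤ y + h), c k ≤
        A' * (h + Real.sqrt (y + h)))
    {Y Y' δ δ' : ℝ} (hY : 1 ≤ Y) (hY' : 1 ≤ Y') (hδ : 0 < δ) (hδ1 : δ ≤ 1) (hδ' : 0 < δ')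
    (hδ'1 : δ' ≤ 1) (K N : ℕ) :
    ∑ k ∈ (Icc 1 K).filter (fun k : ℕ => δ * Y < (k : ℝ)), c k / k *
        (∑ m ∈ Icc 1 N, if Y < (k : ℝ) * m ∧ (k : ℝ) * m ≤ Y * (1 + δ) then (1 : ℝ) / m else 0) *
        (∑ n ∈ Icc 1 N, if Y' < (k : ℝ) * n ∧ (k : ℝ) * n ≤ Y' * (1 + δ') then G n / n else 0) ≤
      4 * A * A' * (δ * (1 + Real.log (2 / δ)) + 4 / Real.sqrt (δ * Y)) := by
  have hY0 : 0 < Y := by linarith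
  have hY'0 : 0 < Y' := by linarith
  set M : ℕ := ⌊2 / δ⌋₊ with hM
  set M' : ℕ := min N M with hM'
  have h2δ : 0 ≤ 2 / δ := by positivity
  -- Step 1: open the `m`-sum, bound the `n`-sum by `4A` and `c(k)/(km)` by `c(k)/Y`,
  -- and restrict to `m ≤ M` (forced by `k > δY`)
  have hstep1 : ∀ k ∈ (Icc 1 K).filter (fun k : ℕ => δ * Y < (k : ℝ)),
      c k / k *
        (∑ m ∈ Icc 1 N, if Y < (k : ℝ) * m ∧ (k : ℝ) * m ≤ Y * (1 + δ) then (1 : ℝ) / m else 0) *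
        (∑ n ∈ Icc 1 N, if Y' < (k : ℝ) * n ∧ (k : ℝ) * n ≤ Y' * (1 + δ') then G n / n else 0) ≤
      ∑ m ∈ Icc 1 M', (if Y < (k : ℝ) * m ∧ (k : ℝ) * m ≤ Y * (1 + δ) then 4 * A / Y * c k else 0) := by
    intro k hk
    rw [mem_filter] at hk
    have hk1 : 1 ≤ k := (mem_Icc.mp hk.1).1
    have hk0 : (0 : ℝ) < k := by exact_mod_cast hk1
    have hNk0 : 0 ≤ ∑ n ∈ Icc 1 N,
        (if Y' < (k : ℝ) * n ∧ (k : ℝ) * n ≤ Y' * (1 + δ') then G n / n else 0) :=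
      sum_nonneg fun n _ => by split_ifs <;> [exact div_nonneg (hG n) (Nat.cast_nonneg n); exact le_rfl]
    rw [mul_assoc, mul_comm (∑ m ∈ Icc 1 N, _) _, ← mul_assoc, mul_sum]
    -- termwise in `m`
    have hterm : ∀ m ∈ Icc 1 N,
        c k / k * (∑ n ∈ Icc 1 N,
            (if Y' < (k : ℝ) * n ∧ (k : ℝ) * n ≤ Y' * (1 + δ') then G n / n else 0)) *
          (if Y < (k : ℝ) * m ∧ (k : ℝ) * m ≤ Y * (1 + δ) then (1 : ℝ) / m else 0) ≤
        (if m ≤ M' then (if Y < (k : ℝ) * m ∧ (k : ℝ) * m ≤ Y * (1 + δ) then 4 * A / Y * c k else 0)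
          else 0) := by
      intro m hm
      have hm1 : 1 ≤ m := (mem_Icc.mp hm).1
      have hmN : m ≤ N := (mem_Icc.mp hm).2
      have hm0 : (0 : ℝ) < m := by exact_mod_cast hm1
      by_cases hW : Y < (k : ℝ) * m ∧ (k : ℝ) * m ≤ Y * (1 + δ)
      · -- `m ≤ M`: `k > δY` and `km ≤ Y(1+δ)` give `m < (1+δ)/δ ≤ 2/δ`
        have hmM : m ≤ M' := by
          refine le_min hmN ?_
          rw [hM, Nat.le_floor_iff h2δ, le_div_iff₀ hδ]
          nlinarith [hW.2, hk.2]
        rw [if_pos hW, if_pos hmM, if_pos hW]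
        have hN := sum_n_window_le hG hA hG1 hY0 hY'0 hδ hδ' hk1 hm1 hW N
        have h4 : A * (1 + δ) * (1 + δ') ≤ 4 * A := by
          have h12 : (1 + δ) * (1 + δ') ≤ 4 := by nlinarith
          nlinarith [mul_le_mul_of_nonneg_left h12 hA]
        calc c k / k * (∑ n ∈ Icc 1 N,
              (if Y' < (k : ℝ) * n ∧ (k : ℝ) * n ≤ Y' * (1 + δ') then G n / n else 0)) * (1 / m)
            ≤ c k / k * (4 * A) * (1 / m) :=
              mul_le_mul_of_nonneg_right (mul_le_mul_of_nonneg_left (hN.trans h4)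
                (div_nonneg (hc k) hk0.le)) (by positivity)
          _ = 4 * A * c k / ((k : ℝ) * m) := by field_simp
          _ ≤ 4 * A * c k / Y :=
              div_le_div_of_nonneg_left (by nlinarith [hc k]) hY0 hW.1.le
          _ = 4 * A / Y * c k := by ring
      · simp only [if_neg hW, mul_zero, ite_self, le_refl]
    have hsub : (Icc 1 N).filter (fun m : ℕ => m ≤ M') ⊆ Icc 1 M' := by
      intro m hm
      rw [mem_filter, mem_Icc] at hm
      exact mem_Icc.mpr ⟨hm.1.1, hm.2⟩
    calc ∑ m ∈ Icc 1 N, c k / k * (∑ n ∈ Icc 1 N,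
            (if Y' < (k : ℝ) * n ∧ (k : ℝ) * n ≤ Y' * (1 + δ') then G n / n else 0)) *
            (if Y < (k : ℝ) * m ∧ (k : ℝ) * m ≤ Y * (1 + δ) then (1 : ℝ) / m else 0)
        ≤ ∑ m ∈ Icc 1 N, (if m ≤ M' then
            (if Y < (k : ℝ) * m ∧ (k : ℝ) * m ≤ Y * (1 + δ) then 4 * A / Y * c k else 0) else 0) :=
          sum_le_sum hterm
      _ = ∑ m ∈ (Icc 1 N).filter (fun m : ℕ => m ≤ M'),
            (if Y < (k : ℝ) * m ∧ (k : ℝ) * m ≤ Y * (1 + δ) then 4 * A / Y * c k else 0) := by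
          rw [sum_filter]
      _ ≤ ∑ m ∈ Icc 1 M',
            (if Y < (k : ℝ) * m ∧ (k : ℝ) * m ≤ Y * (1 + δ) then 4 * A / Y * c k else 0) :=
          sum_le_sum_of_subset_of_nonneg hsub fun m _ _ => by
            split_ifs <;> first | exact le_rfl | exact mul_nonneg (by positivity) (hc k)
  -- Step 2: drop the constraint `k > δY`, exchange, and use the short sums of `c`
  have hstep2 : ∀ m ∈ Icc 1 M',
      ∑ k ∈ Icc 1 K, (if Y < (k : ℝ) * m ∧ (k : ℝ) * m ≤ Y * (1 + δ) then 4 * A / Y * c k else 0) ≤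
        4 * A * A' * (δ / m + Real.sqrt 2 / Real.sqrt Y * (1 / Real.sqrt m)) := by
    intro m hm
    have hm0 : (0 : ℝ) < m := by exact_mod_cast (mem_Icc.mp hm).1
    have hy : 0 ≤ Y / m := by positivity
    have hh : 0 ≤ δ * Y / m := by positivity
    have hb := hc1 K (Y / m) (δ * Y / m) hy hh
    have e : ∑ k ∈ Icc 1 K, (if Y < (k : ℝ) * m ∧ (k : ℝ) * m ≤ Y * (1 + δ) then 4 * A / Y * c k else 0)
        = 4 * A / Y * ∑ k ∈ (Icc 1 K).filter
            (fun k : ℕ => Y / m < (k : ℝ) ∧ (k : ℝ) ≤ Y / m + δ * Y / m), c k := by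
      rw [sum_filter, mul_sum]
      refine sum_congr rfl fun k _ => ?_
      have e1 : (Y < (k : ℝ) * m ∧ (k : ℝ) * m ≤ Y * (1 + δ)) ↔
          (Y / m < (k : ℝ) ∧ (k : ℝ) ≤ Y / m + δ * Y / m) := by
        rw [div_lt_iff₀ hm0, ← add_div, le_div_iff₀ hm0]
        constructor
        · rintro ⟨h1, h2⟩; exact ⟨h1, by linarith⟩
        · rintro ⟨h1, h2⟩; exact ⟨h1, by linarith⟩
      simp only [e1]
      split_ifs <;> simp
    rw [e]
    have hsq : Real.sqrt (Y / m + δ * Y / m) ≤ Real.sqrt 2 * Real.sqrt Y / Real.sqrt m := by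
      rw [← Real.sqrt_mul (by norm_num : (0 : ℝ) ≤ 2), ← Real.sqrt_div (by positivity)]
      apply Real.sqrt_le_sqrt
      rw [← add_div, div_le_div_iff_of_pos_right hm0]
      nlinarith
    have h4AY : 0 ≤ 4 * A / Y := by positivity
    calc 4 * A / Y * ∑ k ∈ (Icc 1 K).filter
            (fun k : ℕ => Y / m < (k : ℝ) ∧ (k : ℝ) ≤ Y / m + δ * Y / m), c k
        ≤ 4 * A / Y * (A' * (δ * Y / m + Real.sqrt (Y / m + δ * Y / m))) :=
          mul_le_mul_of_nonneg_left hb h4AY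
      _ ≤ 4 * A / Y * (A' * (δ * Y / m + Real.sqrt 2 * Real.sqrt Y / Real.sqrt m)) := by gcongr
      _ = 4 * A * A' * (δ / m) * (Y / Y) +
            4 * A * A' * (Real.sqrt 2 * (1 / Real.sqrt m)) * (Real.sqrt Y / Y) := by ring
      _ = 4 * A * A' * (δ / m + Real.sqrt 2 / Real.sqrt Y * (1 / Real.sqrt m)) := by
          rw [div_self hY0.ne', Real.sqrt_div_self']
          ring
  -- Step 3: the two elementary sums over `m ≤ M' ≤ 2/δ`
  have hM'le : (M' : ℝ) ≤ 2 / δ := by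
    have : (M' : ℝ) ≤ M := by exact_mod_cast min_le_right _ _
    exact this.trans (Nat.floor_le h2δ)
  have h2δ1 : (1 : ℝ) ≤ 2 / δ := by rw [le_div_iff₀ hδ]; linarith
  have hlogM' : Real.log M' ≤ Real.log (2 / δ) := by
    rcases Nat.eq_zero_or_pos M' with h0 | hpos
    · rw [h0, Nat.cast_zero, Real.log_zero]; exact Real.log_nonneg h2δ1
    · exact Real.log_le_log (by exact_mod_cast hpos) hM'le
  have hsqM' : Real.sqrt M' ≤ Real.sqrt (2 / δ) := Real.sqrt_le_sqrt hM'le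
  have hsum1 : ∑ m ∈ Icc 1 M', δ / (m : ℝ) ≤ δ * (1 + Real.log (2 / δ)) := by
    have e : ∑ m ∈ Icc 1 M', δ / (m : ℝ) = δ * ∑ m ∈ Icc 1 M', (1 : ℝ) / m := by
      rw [mul_sum]; exact sum_congr rfl fun m _ => by ring
    rw [e]
    exact mul_le_mul_of_nonneg_left ((sum_inv_le_one_add_log M').trans (by linarith)) hδ.le
  have hsum2 : ∑ m ∈ Icc 1 M', Real.sqrt 2 / Real.sqrt Y * (1 / Real.sqrt m) ≤
      4 / Real.sqrt (δ * Y) := by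
    rw [← mul_sum]
    have hsY : 0 < Real.sqrt Y := Real.sqrt_pos.mpr hY0
    have hkey : Real.sqrt 2 / Real.sqrt Y * (2 * Real.sqrt (2 / δ)) = 4 / Real.sqrt (δ * Y) := by
      rw [Real.sqrt_div (by norm_num : (0:ℝ) ≤ 2), Real.sqrt_mul hδ.le]
      have hs2 : Real.sqrt 2 * Real.sqrt 2 = 2 := Real.mul_self_sqrt (by norm_num)
      have hsδ : 0 < Real.sqrt δ := Real.sqrt_pos.mpr hδ
      field_simp
      nlinarith [hs2]
    calc Real.sqrt 2 / Real.sqrt Y * ∑ m ∈ Icc 1 M', 1 / Real.sqrt m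
        ≤ Real.sqrt 2 / Real.sqrt Y * (2 * Real.sqrt (2 / δ)) := by
          refine mul_le_mul_of_nonneg_left ((sum_inv_sqrt_le M').trans ?_) (by positivity)
          linarith
      _ = 4 / Real.sqrt (δ * Y) := hkey
  -- assemble
  calc ∑ k ∈ (Icc 1 K).filter (fun k : ℕ => δ * Y < (k : ℝ)), c k / k *
        (∑ m ∈ Icc 1 N, if Y < (k : ℝ) * m ∧ (k : ℝ) * m ≤ Y * (1 + δ) then (1 : ℝ) / m else 0) *
        (∑ n ∈ Icc 1 N, if Y' < (k : ℝ) * n ∧ (k : ℝ) * n ≤ Y' * (1 + δ') then G n / n else 0)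
      ≤ ∑ k ∈ (Icc 1 K).filter (fun k : ℕ => δ * Y < (k : ℝ)), ∑ m ∈ Icc 1 M',
          (if Y < (k : ℝ) * m ∧ (k : ℝ) * m ≤ Y * (1 + δ) then 4 * A / Y * c k else 0) :=
        sum_le_sum hstep1
    _ ≤ ∑ k ∈ Icc 1 K, ∑ m ∈ Icc 1 M',
          (if Y < (k : ℝ) * m ∧ (k : ℝ) * m ≤ Y * (1 + δ) then 4 * A / Y * c k else 0) :=
        sum_le_sum_of_subset_of_nonneg (filter_subset _ _) fun k _ _ =>
          sum_nonneg fun m _ => by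
            split_ifs <;> first | exact le_rfl | exact mul_nonneg (by positivity) (hc k)
    _ = ∑ m ∈ Icc 1 M', ∑ k ∈ Icc 1 K,
          (if Y < (k : ℝ) * m ∧ (k : ℝ) * m ≤ Y * (1 + δ) then 4 * A / Y * c k else 0) := sum_comm
    _ ≤ ∑ m ∈ Icc 1 M', 4 * A * A' * (δ / m + Real.sqrt 2 / Real.sqrt Y * (1 / Real.sqrt m)) :=
        sum_le_sum hstep2
    _ = 4 * A * A' * (∑ m ∈ Icc 1 M', δ / (m : ℝ) +
          ∑ m ∈ Icc 1 M', Real.sqrt 2 / Real.sqrt Y * (1 / Real.sqrt m)) := by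
        rw [← mul_sum, sum_add_distrib]
    _ ≤ 4 * A * A' * (δ * (1 + Real.log (2 / δ)) + 4 / Real.sqrt (δ * Y)) :=
        mul_le_mul_of_nonneg_left (add_le_add hsum1 hsum2) (by positivity)


/-! ### Part 4. The window-coupled triple-sum bound -/

/-- **The window-coupled counting bound.** Let `c, G ≥ 0` with `Σ_{n≤X} G(n) ≤ AX`,
`Σ_{n≤X} G(n)/n ≤ A(1 + log X)`, `Σ_{n≤X} G(n)/√n ≤ A√X` (all `X`) and the short-sum bound
`Σ_{y<k≤y+h} c(k) ≤ A'(h + √(y+h))` (all `y, h ≥ 0`). Then for `Y, Y' ≥ 1`, `0 < δ, δ' ≤ 1` and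
the windows `W = (Y, Y(1+δ)]`, `W' = (Y', Y'(1+δ')]`,
`Σ_k (c(k)/k)(Σ_{m : km∈W} 1/m)(Σ_{n : kn∈W'} G(n)/n)`
`≤ AA'·(2δ(δ'(1 + log 2Y') + 2) + 4δ(1 + log(2/δ)) + 16/√(δY))`
(for `k ≤ δY` the harmonic window mass is `≤ 2δ` and the `(k,n)`-sum is `sum_kn_window_le`; the
`k > δY` are `sum_tail_window_le`). With `δ = δ' ≍ 𝓛⁻¹⁰`, `Y, Y' ≤ 2P` (`log 2Y' ≍ 𝓛⁹`) the
right side is `O(𝓛⁻¹⁰ log 𝓛)` — one logarithmic range fewer than any bound that decouples `k`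
from the windows. This is the "simple estimates" half of the manuscript's "(8.25), (8.26) and
simple estimates" (§11 p. 64, §12 p. 67) in kernel form, for window-supported coefficients.
[cite: Zhang2022LandauSiegel, §11 p.64; §12 p.67] -/
theorem window_triple_sum_le (hc : ∀ k, 0 ≤ c k) (hG : ∀ n, 0 ≤ G n) (hA : 0 ≤ A) (hA' : 0 ≤ A')
    (hG1 : ∀ X : ℕ, ∑ n ∈ Icc 1 X, G n ≤ A * X)
    (hG2 : ∀ X : ℕ, ∑ n ∈ Icc 1 X, G n / n ≤ A * (1 + Real.log X))
    (hG3 : ∀ X : ℕ, ∑ n ∈ Icc 1 X, G n / Real.sqrt n ≤ A * Real.sqrt X)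
    (hc1 : ∀ (K : ℕ) (y h : ℝ), 0 ≤ y → 0 ≤ h →
      ∑ k ∈ (Icc 1 K).filter (fun k : ℕ => y < (k : ℝ) ∧ (k : ℝ) ≤ y + h), c k ≤
        A' * (h + Real.sqrt (y + h)))
    {Y Y' δ δ' : ℝ} (hY : 1 ≤ Y) (hY' : 1 ≤ Y') (hδ : 0 < δ) (hδ1 : δ ≤ 1) (hδ' : 0 < δ')
    (hδ'1 : δ' ≤ 1) (K N : ℕ) :
    ∑ k ∈ Icc 1 K, c k / k *
        (∑ m ∈ Icc 1 N, if Y < (k : ℝ) * m ∧ (k : ℝ) * m ≤ Y * (1 + δ) then (1 : ℝ) / m else 0) *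
        (∑ n ∈ Icc 1 N, if Y' < (k : ℝ) * n ∧ (k : ℝ) * n ≤ Y' * (1 + δ') then G n / n else 0) ≤
      A * A' * (2 * δ * (δ' * (1 + Real.log (2 * Y')) + 2) +
        4 * (δ * (1 + Real.log (2 / δ))) + 16 / Real.sqrt (δ * Y)) := by
  have hY0 : 0 < Y := by linarith
  -- abbreviations for the three factors
  set F : ℕ → ℝ := fun k => c k / k *
      (∑ m ∈ Icc 1 N, if Y < (k : ℝ) * m ∧ (k : ℝ) * m ≤ Y * (1 + δ) then (1 : ℝ) / m else 0) *
      (∑ n ∈ Icc 1 N, if Y' < (k : ℝ) * n ∧ (k : ℝ) * n ≤ Y' * (1 + δ') then G n / n else 0)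
    with hF
  have hNk0 : ∀ k : ℕ, 0 ≤ ∑ n ∈ Icc 1 N,
      (if Y' < (k : ℝ) * n ∧ (k : ℝ) * n ≤ Y' * (1 + δ') then G n / n else 0) := fun k =>
    sum_nonneg fun n _ => by split_ifs <;> [exact div_nonneg (hG n) (Nat.cast_nonneg n); exact le_rfl]
  -- Part 1: `k ≤ δY`
  have hpart1 : ∑ k ∈ (Icc 1 K).filter (fun k : ℕ => ¬ δ * Y < (k : ℝ)), F k ≤
      2 * δ * (A * A' * (δ' * (1 + Real.log (2 * Y')) + 2)) := by
    have hI := sum_kn_window_le hc hG hA hA' hG2 hG3 hc1 hY' hδ' hδ'1 K N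
    calc ∑ k ∈ (Icc 1 K).filter (fun k : ℕ => ¬ δ * Y < (k : ℝ)), F k
        ≤ ∑ k ∈ (Icc 1 K).filter (fun k : ℕ => ¬ δ * Y < (k : ℝ)), c k / k * (2 * δ) *
            (∑ n ∈ Icc 1 N,
              if Y' < (k : ℝ) * n ∧ (k : ℝ) * n ≤ Y' * (1 + δ') then G n / n else 0) := by
          refine sum_le_sum fun k hk => ?_
          rw [mem_filter] at hk
          have hk1 : 1 ≤ k := (mem_Icc.mp hk.1).1
          have hk0 : (0 : ℝ) < k := by exact_mod_cast hk1
          have hkδ : (k : ℝ) ≤ δ * Y := not_lt.mp hk.2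
          have hM : (∑ m ∈ Icc 1 N,
              if Y < (k : ℝ) * m ∧ (k : ℝ) * m ≤ Y * (1 + δ) then (1 : ℝ) / m else 0) ≤ 2 * δ := by
            rw [← sum_filter]; exact sum_window_inv_le N hk1 hY0 hδ hkδ
          exact mul_le_mul_of_nonneg_right
            (mul_le_mul_of_nonneg_left hM (div_nonneg (hc k) hk0.le)) (hNk0 k)
      _ ≤ ∑ k ∈ Icc 1 K, c k / k * (2 * δ) *
            (∑ n ∈ Icc 1 N,
              if Y' < (k : ℝ) * n ∧ (k : ℝ) * n ≤ Y' * (1 + δ') then G n / n else 0) :=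
          sum_le_sum_of_subset_of_nonneg (filter_subset _ _) fun k hk _ => by
            have hk0 : (0 : ℝ) ≤ k := Nat.cast_nonneg k
            exact mul_nonneg (mul_nonneg (div_nonneg (hc k) hk0) (by positivity)) (hNk0 k)
      _ = 2 * δ * ∑ k ∈ Icc 1 K, c k / k *
            (∑ n ∈ Icc 1 N,
              if Y' < (k : ℝ) * n ∧ (k : ℝ) * n ≤ Y' * (1 + δ') then G n / n else 0) := by
          rw [mul_sum]
          exact sum_congr rfl fun k _ => by ring
      _ ≤ 2 * δ * (A * A' * (δ' * (1 + Real.log (2 * Y')) + 2)) :=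
          mul_le_mul_of_nonneg_left hI (by positivity)
  -- Part 2: `k > δY`
  have hpart2 : ∑ k ∈ (Icc 1 K).filter (fun k : ℕ => δ * Y < (k : ℝ)), F k ≤
      4 * A * A' * (δ * (1 + Real.log (2 / δ)) + 4 / Real.sqrt (δ * Y)) :=
    sum_tail_window_le hc hG hA hA' hG1 hc1 hY hY' hδ hδ1 hδ' hδ'1 K N
  -- assemble
  have hsplit : ∑ k ∈ Icc 1 K, F k =
      ∑ k ∈ (Icc 1 K).filter (fun k : ℕ => δ * Y < (k : ℝ)), F k +
        ∑ k ∈ (Icc 1 K).filter (fun k : ℕ => ¬ δ * Y < (k : ℝ)), F k :=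
    (sum_filter_add_sum_filter_not _ _ _).symm
  calc ∑ k ∈ Icc 1 K, F k
      = ∑ k ∈ (Icc 1 K).filter (fun k : ℕ => δ * Y < (k : ℝ)), F k +
          ∑ k ∈ (Icc 1 K).filter (fun k : ℕ => ¬ δ * Y < (k : ℝ)), F k := hsplit
    _ ≤ 4 * A * A' * (δ * (1 + Real.log (2 / δ)) + 4 / Real.sqrt (δ * Y)) +
          2 * δ * (A * A' * (δ' * (1 + Real.log (2 * Y')) + 2)) := add_le_add hpart2 hpart1
    _ = A * A' * (2 * δ * (δ' * (1 + Real.log (2 * Y')) + 2) +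
          4 * (δ * (1 + Real.log (2 / δ))) + 16 / Real.sqrt (δ * Y)) := by ring

end Engine

end Literature.NumberTheory.LFunctions.Zhang2022.SjWindowEngine
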